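import Mathlib
import HarnessLib
import Summits.HubbardSuperconductivity.HubbardSuperconductivity.Theorems.WeakCouplingBCSWcbcsSsbToTorusLROMomentClosure

/-!
# Crux `WindowInfraredBound` (stmt-HubbardSuperconductivity-1089), line `pair-gaussian-domination-energy-form`:
# stub RMC `stub_pgdRegularisedMomentClosure` — the regularised resolvent-free moment closure (proved)

For a normalised ground state `ψ` of `H = hubbardTorus 2 L 1 U` in the joint sector `(N, S^z = 0)`,
`N ≥ 2`, a momentum label `m`, the pair mode `Δ = pairFieldAt dWaveFormFactor L m`, real data
`X, B₁, B₂, B₃, g, λ ≥ 0`, write `E = minEnergyOn H (szSector N 0)`, `E∓ = minEnergyOn H (szSector (N ∓ 2) 0)`,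
`v₋ = Δψ`, `v₊ = Δᴴψ`, `S∓ = ‖v∓‖²`, `F'∓ = Re⟨v∓, H v∓⟩ − (E∓ − λ) S∓`. IF

* (T_λ₋) `2 Re⟨w, v₋⟩ − (Re⟨w, H w⟩ − (E₋ − λ)‖w‖²) ≤ X` for all `w ∈ szSector (N − 2) 0`, (T_λ₊) the same
  with `v₊`, `E₊` on `szSector (N + 2) 0`;
* (F1) `Re⟨ψ, (Δᴴ[H,Δ] − [H,Δ]Δᴴ)ψ⟩ ≤ B₁`; (F2) `|Re⟨ψ, (ΔᴴΔ − ΔΔᴴ)ψ⟩| ≤ B₂`; (F3) `|E − E₋| ≤ B₃`;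
  (C) `−g ≤ pairGap H N = (E₊ + E₋ − 2E)/2`,

THEN `S₋ ≤ 2√((B₁ + B₃ B₂) X) + (4 g + 2 λ) X`. This is the landed `λ = 0` closure
`WcbcsSsbToTorusLRO.stub_momentClosure` with the own bottoms `E∓` lowered by the regulariser `λ`:

1. sector bookkeeping `v₋ ∈ szSector (N−2) 0`, `v₊ ∈ szSector (N+2) 0`
   (`WcbcsSsbToTorusLRO.pairFieldAt_mulVec_mem_szSector`, `…conjTranspose_pairFieldAt_mulVec_mem_szSector`);
2. the Pitaevskii–Stringari kernel `WcbcsSsbToTorusLRO.momentKernel` at the levels `E∓ − λ`: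
   `F'∓ ≥ 0` and `S∓² ≤ F'∓ · X`;
3. the own-bottom identity `WcbcsSsbToTorusLRO.mc_dotProduct_doubleComm_of_eigen` (`Hψ = Eψ`, `H` Hermitian):
   `F'₋ + F'₊ = Re⟨ψ,(Δᴴ[H,Δ] − [H,Δ]Δᴴ)ψ⟩ + (E − E₋)(S₋ − S₊) − 2·pairGap·S₊ + λ(S₋ + S₊)
    ≤ B₁ + B₃B₂ + 2gS₊ + λ(S₋ + S₊)`;
4. the real endgame `rmc_endgame_real`: with `M = max S₋ S₊`, `M² ≤ (B + (2g + 2λ)M)X`, whence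
   `M ≤ √(BX) + (2g + 2λ)X ≤ 2√(BX) + (4g + 2λ)X`.

L. Pitaevskii, S. Stringari, J. Low Temp. Phys. 85 (1991) 377 (moment inequalities); H. Tasaki,
H. Watanabe (2021). Folklore finite-dimensional linear algebra over the tree's definitions; no definition
and no named fact is introduced.
-/

namespace Summit.HubbardSuperconductivity.HubbardSuperconductivity.Theorems.WindowInfraredBound

-- summit = problem name (single-conjunct summit, D-0017): `HubbardSuperconductivity` occurs twice in the path
set_option linter.dupNamespace false

open Literature.MathematicalPhysics.QuantumLattice Literature.Probability.LatticeModels Matrix Finset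
open scoped ComplexOrder ComplexConjugate

/-! ## §1 Real arithmetic -/

/-- **Quadratic self-consistency.** If `r, c ≥ 0` and `M² ≤ r² + c M` then `M ≤ r + c`
(otherwise `M > 0` and `M² > M(r + c) ≥ r·r + cM`). [folklore] -/
theorem rmc_quadratic_real {M r c : ℝ} (hr : 0 ≤ r) (hc : 0 ≤ c) (h : M ^ 2 ≤ r ^ 2 + c * M) :
    M ≤ r + c := by
  by_contra hlt
  push Not at hlt
  have hMpos : 0 < M := lt_of_le_of_lt (by positivity) hlt
  have h2 := mul_lt_mul_of_pos_left hlt hMpos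
  have h3 : r * r ≤ r * M := mul_le_mul_of_nonneg_left (by linarith) hr
  nlinarith [h, h2, h3]

/-- **The real endgame of the regularised closure.** From the two kernels `S∓² ≤ F'∓ X` (which force
`F'∓ X ≥ 0`) and the own-bottom budget `F'₋ + F'₊ ≤ B + 2 g S₊ + λ (S₋ + S₊)` (`X, B, g, λ ≥ 0`): with
`M = max S₋ S₊` one has `M² ≤ (F'₋ + F'₊) X ≤ (√(BX))² + ((2g + 2λ)X)·M`, so
`S₋ ≤ M ≤ √(BX) + (2g + 2λ)X ≤ 2√(BX) + (4g + 2λ)X` (`rmc_quadratic_real`). [folklore] -/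
theorem rmc_endgame_real {Sm Sp Fm Fp X B g lam : ℝ} (hX : 0 ≤ X) (hB : 0 ≤ B) (hg : 0 ≤ g)
    (hlam : 0 ≤ lam) (hKm : Sm ^ 2 ≤ Fm * X) (hKp : Sp ^ 2 ≤ Fp * X)
    (hsum : Fm + Fp ≤ B + 2 * g * Sp + lam * (Sm + Sp)) :
    Sm ≤ 2 * Real.sqrt (B * X) + (4 * g + 2 * lam) * X := by
  set r := Real.sqrt (B * X) with hr
  have hr0 : 0 ≤ r := Real.sqrt_nonneg _
  have hr2 : r ^ 2 = B * X := Real.sq_sqrt (mul_nonneg hB hX)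
  have hgX : 0 ≤ g * X := mul_nonneg hg hX
  have hlX : 0 ≤ lam * X := mul_nonneg hlam hX
  have hc : 0 ≤ (2 * g + 2 * lam) * X := by positivity
  -- `M = max S₋ S₊`; both kernels give `M² ≤ (F'₋ + F'₊) X`
  set M := max Sm Sp with hMdef
  have hSmM : Sm ≤ M := le_max_left _ _
  have hSpM : Sp ≤ M := le_max_right _ _
  have hKM : M ^ 2 ≤ (Fm + Fp) * X := by
    rcases le_total Sm Sp with hle | hle
    · have hMe : M = Sp := max_eq_right hle
      rw [hMe]
      nlinarith [hKp, hKm, sq_nonneg Sm]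
    · have hMe : M = Sm := max_eq_left hle
      rw [hMe]
      nlinarith [hKm, hKp, sq_nonneg Sp]
  -- the budget in terms of `M`
  have hsumM : Fm + Fp ≤ B + (2 * g + 2 * lam) * M := by
    have h1 : 2 * g * Sp ≤ 2 * g * M := mul_le_mul_of_nonneg_left hSpM (by positivity)
    have h2 : lam * (Sm + Sp) ≤ lam * (M + M) := mul_le_mul_of_nonneg_left (by linarith) hlam
    linarith
  have hquad : M ^ 2 ≤ r ^ 2 + (2 * g + 2 * lam) * X * M := by
    have := mul_le_mul_of_nonneg_right hsumM hX
    nlinarith [this, hr2]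
  have hMle : M ≤ r + (2 * g + 2 * lam) * X := rmc_quadratic_real hr0 hc hquad
  linarith [hMle, hSmM, hr0, hgX, hlX]

/-! ## §2 The stub -/

/-- **Stub RMC — `stub_pgdRegularisedMomentClosure` (finite-dimensional).** The resolvent-free
Pitaevskii–Stringari closure with a regulariser `λ ≥ 0`: from the regularised variational stiffness
bounds (T_λ∓) (own bottoms lowered by `λ`), the double-commutator budget `B₁`, the pair-commutator budget
`B₂`, the two-particle cost `B₃` and the charging floor `−g ≤ pairGap H N`, the pair-removal weight obeys
`‖Δψ‖² ≤ 2√((B₁ + B₃B₂)X) + (4g + 2λ)X`. (At `λ = 0` this is the landed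
`WcbcsSsbToTorusLRO.stub_momentClosure`, up to the factor 2.) Proof: `Δψ ∈ (N−2,0)`, `Δᴴψ ∈ (N+2,0)`;
the kernel `WcbcsSsbToTorusLRO.momentKernel` at the levels `E∓ − λ` (`F'∓ ≥ 0`, `S∓² ≤ F'∓ X`); the own-bottom
identity `WcbcsSsbToTorusLRO.mc_dotProduct_doubleComm_of_eigen` giving
`F'₋ + F'₊ ≤ B₁ + B₃B₂ + 2gS₊ + λ(S₋ + S₊)`; and `rmc_endgame_real`.
Pitaevskii–Stringari (1991); Tasaki–Watanabe (2021). [folklore] -/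
theorem stub_pgdRegularisedMomentClosure :
    ∀ (L : ℕ) [NeZero L] (U : ℝ) (N : ℕ), 2 ≤ N → ∀ (ψ : Fock (Orb (FermionTorus 2 L))), IsGroundStateInSector (hubbardTorus 2 L 1 U) N 0 ψ → star ψ ⬝ᵥ ψ = 1 → ∀ (m : TorusSite 2 L) (X B₁ B₂ B₃ g lam : ℝ), 0 ≤ X → 0 ≤ B₁ → 0 ≤ B₂ → 0 ≤ B₃ → 0 ≤ g → 0 ≤ lam → (∀ w : Fock (Orb (FermionTorus 2 L)), w ∈ szSector (N - 2) 0 → 2 * (star w ⬝ᵥ (pairFieldAt dWaveFormFactor L m *ᵥ ψ)).re - ((star w ⬝ᵥ (hubbardTorus 2 L 1 U *ᵥ w)).re - ((hubbardTorus 2 L 1 U).minEnergyOn (szSector (N - 2) 0) - lam) * (star w ⬝ᵥ w).re) ≤ X) → (∀ w : Fock (Orb (FermionTorus 2 L)), w ∈ szSector (N + 2) 0 → 2 * (star w ⬝ᵥ ((pairFieldAt dWaveFormFactor L m)ᴴ *ᵥ ψ)).re - ((star w ⬝ᵥ (hubbardTorus 2 L 1 U *ᵥ w)).re - ((hubbardTorus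 2 L 1 U).minEnergyOn (szSector (N + 2) 0) - lam) * (star w ⬝ᵥ w).re) ≤ X) → (star ψ ⬝ᵥ (((pairFieldAt dWaveFormFactor L m)ᴴ * (hubbardTorus 2 L 1 U * pairFieldAt dWaveFormFactor L m - pairFieldAt dWaveFormFactor L m * hubbardTorus 2 L 1 U) - (hubbardTorus 2 L 1 U * pairFieldAt dWaveFormFactor L m - pairFieldAt dWaveFormFactor L m * hubbardTorus 2 L 1 U) * (pairFieldAt dWaveFormFactor L m)ᴴ) *ᵥ ψ)).re ≤ B₁ → |(star ψ ⬝ᵥ (((pairFieldAt dWaveFormFactor L m)ᴴ * pairFieldAt dWaveFormFactor L m - pairFieldAt dWaveFormFactor L m * (pairFieldAt dWaveFormFactor L m)ᴴ) *ᵥ ψ)).re| ≤ B₂ → |(hubbardTorus 2 L 1 U).minEnergyOn (szSector N 0) - (hubbardTorus 2 L 1 U).minEnergyOn (szSector (N - 2) 0)| ≤ B₃ → -g ≤ pairGap (hubbardTorus 2 L 1 U) N → (star (pairFieldAt dWaveFormFactor L m *ᵥ ψ) ⬝ᵥ (pairFieldAt dWaveFormFactor L m *ᵥ ψ)).re ≤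 2 * Real.sqrt ((B₁ + B₃ * B₂) * X) + (4 * g + 2 * lam) * X := by
  intro L _ U N hN ψ hψ _hψ1 m X B₁ B₂ B₃ g lam hX hB₁ hB₂ hB₃ hg hlam hTm hTp hF1 hF2 hF3 hC
  unfold pairGap at hC
  set H := hubbardTorus 2 L 1 U with hHdef
  set Δ := pairFieldAt dWaveFormFactor L m with hΔdef
  set E := H.minEnergyOn (szSector N 0) with hEdef
  set Em := H.minEnergyOn (szSector (N - 2) 0) with hEmdef
  set Ep := H.minEnergyOn (szSector (N + 2) 0) with hEpdef
  obtain ⟨hψK, -, hHψ⟩ := hψ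
  have hHerm : H.IsHermitian := LiebThm1.hamiltonian_isHermitian (fermionTorusGraph 2 L) 1 U
  -- (1) sector bookkeeping
  have hvm : Δ *ᵥ ψ ∈ szSector (N - 2) 0 :=
    WcbcsSsbToTorusLRO.pairFieldAt_mulVec_mem_szSector dWaveFormFactor m hN hψK
  have hvp : Δᴴ *ᵥ ψ ∈ szSector (N + 2) 0 :=
    WcbcsSsbToTorusLRO.conjTranspose_pairFieldAt_mulVec_mem_szSector dWaveFormFactor m hψK
  -- (2) the two kernels at the regularised levels `E∓ − λ`
  obtain ⟨-, hKm⟩ := WcbcsSsbToTorusLRO.momentKernel H (szSector (N - 2) 0) (Em - lam) X hvm hTm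
  obtain ⟨-, hKp⟩ := WcbcsSsbToTorusLRO.momentKernel H (szSector (N + 2) 0) (Ep - lam) X hvp hTp
  -- (3) the own-bottom identity
  rw [WcbcsSsbToTorusLRO.mc_dotProduct_doubleComm_of_eigen hHerm hHψ Δ] at hF1
  simp only [Complex.add_re, Complex.sub_re, Complex.re_ofReal_mul] at hF1
  have hSm : star (Δ *ᵥ ψ) ⬝ᵥ (Δ *ᵥ ψ) = star ψ ⬝ᵥ ((Δᴴ * Δ) *ᵥ ψ) :=
    star_mulVec_dotProduct_mulVec Δ Δ ψ
  have hSp : star (Δᴴ *ᵥ ψ) ⬝ᵥ (Δᴴ *ᵥ ψ) = star ψ ⬝ᵥ ((Δ * Δᴴ) *ᵥ ψ) := by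
    rw [star_mulVec_dotProduct_mulVec, conjTranspose_conjTranspose]
  have hdiff : (star ψ ⬝ᵥ ((Δᴴ * Δ - Δ * Δᴴ) *ᵥ ψ)).re =
      (star (Δ *ᵥ ψ) ⬝ᵥ (Δ *ᵥ ψ)).re - (star (Δᴴ *ᵥ ψ) ⬝ᵥ (Δᴴ *ᵥ ψ)).re := by
    rw [sub_mulVec, dotProduct_sub, Complex.sub_re, hSm, hSp]
  rw [hdiff] at hF2
  have hSp0 : 0 ≤ (star (Δᴴ *ᵥ ψ) ⬝ᵥ (Δᴴ *ᵥ ψ)).re :=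
    (Complex.nonneg_iff.1 (dotProduct_star_self_nonneg _)).1
  set Sm := (star (Δ *ᵥ ψ) ⬝ᵥ (Δ *ᵥ ψ)).re with hSmdef
  set Sp := (star (Δᴴ *ᵥ ψ) ⬝ᵥ (Δᴴ *ᵥ ψ)).re with hSpdef
  set am := (star (Δ *ᵥ ψ) ⬝ᵥ (H *ᵥ (Δ *ᵥ ψ))).re with hamdef
  set ap := (star (Δᴴ *ᵥ ψ) ⬝ᵥ (H *ᵥ (Δᴴ *ᵥ ψ))).re with hapdef
  -- the own-bottom budget `F'₋ + F'₊ ≤ B₁ + B₃ B₂ + 2 g S₊ + λ (S₋ + S₊)`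
  have h1 : (E - Em) * (Sm - Sp) ≤ B₃ * B₂ :=
    calc (E - Em) * (Sm - Sp) ≤ |(E - Em) * (Sm - Sp)| := le_abs_self _
      _ = |E - Em| * |Sm - Sp| := abs_mul _ _
      _ ≤ B₃ * B₂ := mul_le_mul hF3 hF2 (abs_nonneg _) hB₃
  have h2 : (2 * E - Em - Ep) * Sp ≤ 2 * g * Sp := mul_le_mul_of_nonneg_right (by linarith) hSp0
  have hsum : (am - (Em - lam) * Sm) + (ap - (Ep - lam) * Sp) ≤
      (B₁ + B₃ * B₂) + 2 * g * Sp + lam * (Sm + Sp) := by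
    nlinarith [hF1, h1, h2]
  -- (4) the real endgame
  exact rmc_endgame_real hX (by positivity) hg hlam hKm hKp hsum

end Summit.HubbardSuperconductivity.HubbardSuperconductivity.Theorems.WindowInfraredBound
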